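import Mathlib
import HarnessLib
import Literature.Analysis.FluidPDE.Tao2016AveragedNS.LocalCascadeSolutions
import Literature.Analysis.FluidPDE.Tao2016AveragedNS.RenormalisedCascadeWaves
import Literature.Analysis.FluidPDE.Tao2016AveragedNS.SelfSimilarCascadeBlowup
import Literature.Analysis.FluidPDE.Tao2016AveragedNS.SelfSimilarCascadeResidues
import Literature.Analysis.FluidPDE.Tao2016AveragedNS.ViscousEternalSolutions
import Literature.Analysis.FluidPDE.Tao2016AveragedNS.BoundedEternalSolutions
import Summits.NavierStokesRegularity.NavierStokesRegularity.Theses.TaoLadderRungTwoBreak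

/-!
# The SMALL-ACTION slice of K1ᵛ(1) `TaoLadderRungTwoBreak.NoSurvivingEternalViscBddOne`
# (stmt-NavierStokesRegularity-20419): a lossy-conveyor bound for EVERY bounded admissible eternal solution

MODEL lattice ODEs only (Tao 2016 §4, §6.4; cell vocabulary `IsEternalVisc`, `UniformBound`, `physEnergy`,
`physFlux`, `EternalSurvivingFwd`); nothing here is a statement about the Navier–Stokes equations; no summit,
crux or rung LEAF is proved (`--supports stmt-NavierStokesRegularity-20419`).

For a uniformly bounded admissible eternal solution `W` of the renormalised lattice of a CANCELLING table with
ANY covariant viscosity `ν̂ ≥ 0` (not assumed self-similar), write `E_k = physEnergy` (physical shell energy),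
`F_k = physFlux`, `C_A = fluxConst α`, and let `M` bound the per-shell actions `∫‖W_n‖` (the admissibility
clause).  Integrating the tree's shell identity `E_{k+1}' = F_k − F_{k+1} − (dissipation)` from the far past
(`E_{k+1}(−∞) = 0` by boundedness) with `|F_j| ≤ 2C_AΛ⁻¹‖W_{j+1}‖E_j` gives the **conveyor inequality**
(`physEnergy_succ_le_action`)

  `sup E_{k+1} ≤ κ·(sup E_k + sup E_{k+1})`,  `κ := 2C_AΛ⁻¹M`,

hence for `κ < 1` the **lossy-conveyor bound** `sup_σ E_{k+1} ≤ (κ/(1−κ))·sup_σ E_k` (`physEnergy_succ_le_ratio`)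
and `sup_σ E_n ≤ (κ/(1−κ))ⁿ·sup_σ E_0` (`physEnergy_le_pow`): a shell field whose shells each make few weighted
turnovers transmits energy upward with efficiency at most `κ/(1−κ)` per shell.  Forward (S₁)-survival needs
efficiency `≥ (1+ε₀)⁻¹`, so (`not_survivingFwd_of_smallAction`)

  **`(2+ε₀)·κ < 1 ⟹ W is not forward (S₁)-surviving`** — every `ε₀ > 0`, every cancelling table, every `ν̂ ≥ 0`.

Consequently the **small-action slice of K1ᵛ(1) is a THEOREM** (`noSurvivingEternalViscBdd_rung_smallAction`:
threshold `εs = 1`, action budget `∫‖W_n‖ ≤ 1/400` on every table of every class `InTableClass R`, using only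
`|α| ≤ 1` and cancellation), simultaneously a slice of both split children (ρ0) `NoSurvivingEternalBddOne` /
(ρ+) `NoLoudLadderOne`, and a case of the crux BY NAME (`smallAction_of_noSurvivingEternalViscBddOne`).  It is
the non-self-similar, small-action counterpart of the DSS ACTION FLOOR (`…NoSurvivingDSSOneActionFloor`:
`He^{H} ≳ 1/ε₀`) and complements the tree's small-AMPLITUDE Liouville theorem (`…SmallAmplitudeRung`,
`sup‖W‖ ≤ 1/1000 ⇒ W = 0`): small action ≠ small amplitude.  What K1ᵛ(1) adds is the regime of actions
`M ≥ Λ/((2+ε₀)·2C_A)`.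
-/

noncomputable section

-- the summit and its single sub-problem share the name (CONVENTIONS §1)
set_option linter.dupNamespace false

namespace Summit.NavierStokesRegularity.NavierStokesRegularity.Theorems.NoSurvivingEternalViscBddOne.SmallAction

open Set Filter Topology MeasureTheory
open scoped RealInnerProductSpace
open Literature.Analysis.FluidPDE Literature.Analysis.FluidPDE.TaoCascade
open Summit.NavierStokesRegularity.NavierStokesRegularity.Theses.TaoLadderRungTwoBreak

variable {m : ℕ} {ε₀ νh : ℝ} {α : Fin m → Fin m → Fin m → ℤ × ℤ × ℤ → ℝ} {W : ℤ → ℝ → Em m}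

/-! ## Continuity, global bounds, far past -/

/-- `E_k` is continuous. [cite: Tao2016AveragedNS, §4 Lemma 4.1 (4.10), §6.4; cell vocabulary] -/
theorem continuous_physEnergy (hW : IsEternalVisc ε₀ νh α W) (k : ℤ) : Continuous (physEnergy ε₀ W k) := by
  have := (continuous_iff_continuousAt.2 fun σ' => (hW.law k σ').continuousAt : Continuous (W k))
  unfold physEnergy; fun_prop

/-- `F_k` is continuous. [cite: Tao2016AveragedNS, §4 Lemma 4.1 (4.9), §6.4; cell vocabulary] -/
theorem continuous_physFlux (hW : IsEternalVisc ε₀ νh α W) (hc : IsCancellingCoeff α) (k : ℤ) :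
    Continuous (physFlux ε₀ α W k) := by
  have h1 := (continuous_iff_continuousAt.2 fun σ' => (hW.law (k + 1) σ').continuousAt : Continuous (W (k + 1)))
  have h0 := (continuous_iff_continuousAt.2 fun σ' => (hW.law k σ').continuousAt : Continuous (W k))
  have h2 : Continuous fun σ => tableA α (W k σ) := (table_sTable α hc).contA.comp h0
  unfold physFlux
  exact continuous_const.mul ((by fun_prop : Continuous fun σ => Real.exp (2 * σ)).mul (h1.inner h2))

/-- `E_k(σ) ≤ Λ^{-2k} B² e^{2σ}` under the uniform bound `‖W‖ ≤ B`. [cite: Tao2016AveragedNS, §4 Lemma 4.1 (4.10), §6.4; elementary] -/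
theorem physEnergy_le_exp (hε : 0 < ε₀) {B : ℝ} (hB : ∀ k σ, ‖W k σ‖ ≤ B) (k : ℤ) (σ : ℝ) :
    physEnergy ε₀ W k σ ≤ (bigLam ε₀ ^ k)⁻¹ ^ 2 * B ^ 2 * Real.exp (2 * σ) := by
  have hΛ : 0 < bigLam ε₀ ^ k := zpow_pos (bigLam_pos (by linarith)) k
  have h0 : 0 ≤ ‖W k σ‖ := norm_nonneg _
  have h1 : ‖W k σ‖ ^ 2 ≤ B ^ 2 := pow_le_pow_left₀ h0 (hB k σ) 2
  unfold physEnergy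
  calc (bigLam ε₀ ^ k)⁻¹ ^ 2 * (Real.exp (2 * σ) * ‖W k σ‖ ^ 2)
      ≤ (bigLam ε₀ ^ k)⁻¹ ^ 2 * (Real.exp (2 * σ) * B ^ 2) :=
        mul_le_mul_of_nonneg_left (mul_le_mul_of_nonneg_left h1 (Real.exp_pos _).le) (by positivity)
    _ = (bigLam ε₀ ^ k)⁻¹ ^ 2 * B ^ 2 * Real.exp (2 * σ) := by ring

/-- `E_k → 0` in the far past for a uniformly bounded field. [cite: Tao2016AveragedNS, §4 Lemma 4.1 (4.10), §6.4; elementary] -/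
theorem tendsto_physEnergy_atBot (hε : 0 < ε₀) (hU : UniformBound W) (k : ℤ) :
    Tendsto (physEnergy ε₀ W k) atBot (𝓝 0) := by
  obtain ⟨B, hB⟩ := hU
  have hexp : Tendsto (fun x : ℝ => Real.exp (2 * x)) atBot (𝓝 0) :=
    Real.tendsto_exp_atBot.comp (tendsto_id.const_mul_atBot (by norm_num : (0 : ℝ) < 2))
  have hup : Tendsto (fun σ => (bigLam ε₀ ^ k)⁻¹ ^ 2 * B ^ 2 * Real.exp (2 * σ)) atBot (𝓝 0) := by
    have h := hexp.const_mul ((bigLam ε₀ ^ k)⁻¹ ^ 2 * B ^ 2)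
    rwa [mul_zero] at h
  exact tendsto_of_tendsto_of_tendsto_of_le_of_le tendsto_const_nhds hup
    (fun σ => physEnergy_nonneg ε₀ W k σ) (fun σ => physEnergy_le_exp hε hB k σ)

/-- Every shell energy of a uniformly bounded admissible eternal solution is GLOBALLY bounded in log-time
(uniform bound in the past, the admissibility clause `bdd` in the future). [cite: Tao2016AveragedNS, §4 Lemma 4.1 (4.10), §6.4; cell vocabulary] -/
theorem exists_physEnergy_le (hε : 0 < ε₀) (hW : IsEternalVisc ε₀ νh α W) (hU : UniformBound W) (k : ℤ) :
    ∃ S : ℝ, ∀ σ, physEnergy ε₀ W k σ ≤ S := by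
  obtain ⟨B, hB⟩ := hU
  obtain ⟨σ₀, P, hP⟩ := hW.bdd k
  have hΛ : 0 < bigLam ε₀ ^ k := zpow_pos (bigLam_pos (by linarith)) k
  have hP0 : 0 ≤ P := le_trans (by positivity) (hP σ₀ le_rfl)
  refine ⟨(bigLam ε₀ ^ k)⁻¹ ^ 2 * B ^ 2 * Real.exp (2 * σ₀) + (bigLam ε₀ ^ k)⁻¹ ^ 2 * P, fun σ => ?_⟩
  by_cases hσ : σ ≤ σ₀
  · have h1 := physEnergy_le_exp hε hB k σ
    have h2 : (bigLam ε₀ ^ k)⁻¹ ^ 2 * B ^ 2 * Real.exp (2 * σ)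
        ≤ (bigLam ε₀ ^ k)⁻¹ ^ 2 * B ^ 2 * Real.exp (2 * σ₀) :=
      mul_le_mul_of_nonneg_left (Real.exp_le_exp.2 (by linarith)) (by positivity)
    have h3 : 0 ≤ (bigLam ε₀ ^ k)⁻¹ ^ 2 * P := by positivity
    linarith
  · push Not at hσ
    have h1 : physEnergy ε₀ W k σ ≤ (bigLam ε₀ ^ k)⁻¹ ^ 2 * P := by
      unfold physEnergy
      exact mul_le_mul_of_nonneg_left (hP σ hσ.le) (by positivity)
    have h3 : 0 ≤ (bigLam ε₀ ^ k)⁻¹ ^ 2 * B ^ 2 * Real.exp (2 * σ₀) := by positivity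
    linarith

/-! ## The conveyor inequality -/

/-- The covariant viscosity coefficient is non-negative. [cite: Tao2016AveragedNS, §4, the viscous equation before Thm. 4.2; cell vocabulary] -/
theorem viscCoef_nonneg (hε : 0 < ε₀) (hν : 0 ≤ νh) (k : ℤ) (σ : ℝ) : 0 ≤ viscCoef ε₀ νh k σ := by
  unfold viscCoef
  have : 0 < (1 + ε₀) ^ ((2 : ℝ) * k) := Real.rpow_pos_of_pos (by linarith) _
  positivity

/-- **The conveyor inequality.**  For a uniformly bounded admissible eternal solution (any `ν̂ ≥ 0`) of a
cancelling table with per-shell actions `∫‖W_n‖ ≤ M`: if `E_k ≤ A` and `E_{k+1} ≤ S` at all log-times then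
`E_{k+1} ≤ κ(A + S)` at all log-times, `κ = 2C_AΛ⁻¹M` — everything in shell `k+1` came through the bond
`k → k+1` (`E_{k+1}(−∞) = 0`), whose total traffic in either direction is bounded by the action.
[cite: Tao2016AveragedNS, §4 Lemma 4.1 (4.8)–(4.10) with (4.3), the viscous equation before Thm. 4.2, §6.4; cell lemma `hasDerivAt_physEnergy` + this file] -/
theorem physEnergy_succ_le_action (hε : 0 < ε₀) (hW : IsEternalVisc ε₀ νh α W) (hc : IsCancellingCoeff α)
    (hU : UniformBound W) {M : ℝ} (hint : ∀ n, Integrable (fun σ => ‖W n σ‖))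
    (hM : ∀ n, ∫ σ, ‖W n σ‖ ≤ M) {k : ℤ} {A S : ℝ}
    (hA : ∀ σ, physEnergy ε₀ W k σ ≤ A) (hS : ∀ σ, physEnergy ε₀ W (k + 1) σ ≤ S) :
    ∀ σ, physEnergy ε₀ W (k + 1) σ ≤ 2 * fluxConst α * (bigLam ε₀)⁻¹ * M * (A + S) := by
  set κ₀ := 2 * fluxConst α * (bigLam ε₀)⁻¹ with hκ₀
  have hΛ : 0 < bigLam ε₀ := bigLam_pos (by linarith)
  have hκ₀nn : 0 ≤ κ₀ := by have := fluxConst_nonneg α; positivity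
  have hA0 : 0 ≤ A := (physEnergy_nonneg ε₀ W k 0).trans (hA 0)
  have hS0 : 0 ≤ S := (physEnergy_nonneg ε₀ W (k + 1) 0).trans (hS 0)
  -- the derivative of `E_{k+1}` and its pointwise majorant
  set D : ℝ → ℝ := fun s => physFlux ε₀ α W k s - physFlux ε₀ α W (k + 1) s
      - 2 * viscCoef ε₀ νh (k + 1) s * physEnergy ε₀ W (k + 1) s with hD
  have hderiv : ∀ s, HasDerivAt (physEnergy ε₀ W (k + 1)) (D s) s := by
    intro s
    have h := hasDerivAt_physEnergy hε hW hc (k + 1) s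
    rwa [add_sub_cancel_right] at h
  have hDcont : Continuous D := by
    have h1 := continuous_physFlux hW hc k
    have h2 := continuous_physFlux hW hc (k + 1)
    have h3 := continuous_physEnergy hW (k + 1)
    have h4 : Continuous fun s => viscCoef ε₀ νh (k + 1) s := by unfold viscCoef; fun_prop
    simp only [hD]; fun_prop
  set G : ℝ → ℝ := fun s => κ₀ * A * ‖W (k + 1) s‖ + κ₀ * S * ‖W (k + 1 + 1) s‖ with hG
  have hGcont : Continuous G := by
    have h1 := ((continuous_iff_continuousAt.2 fun σ' => (hW.law (k + 1) σ').continuousAt : Continuous (W (k + 1)))).norm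
    have h2 := ((continuous_iff_continuousAt.2 fun σ' => (hW.law (k + 1 + 1) σ').continuousAt : Continuous (W (k + 1 + 1)))).norm
    simp only [hG]; fun_prop
  have hDG : ∀ s, D s ≤ G s := by
    intro s
    have hF1 := (le_abs_self _).trans (abs_physFlux_le hε hc W k s)
    have hF2 := (neg_le_abs _).trans (abs_physFlux_le hε hc W (k + 1) s)
    have hvis : 0 ≤ 2 * viscCoef ε₀ νh (k + 1) s * physEnergy ε₀ W (k + 1) s :=
      mul_nonneg (mul_nonneg two_pos.le (viscCoef_nonneg hε hW.nonneg _ _)) (physEnergy_nonneg ε₀ W _ s)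
    have hb1 : 2 * fluxConst α * (bigLam ε₀)⁻¹ * ‖W (k + 1) s‖ * physEnergy ε₀ W k s
        ≤ κ₀ * A * ‖W (k + 1) s‖ := by
      rw [hκ₀]
      have := mul_le_mul_of_nonneg_left (hA s) (mul_nonneg hκ₀nn (norm_nonneg (W (k + 1) s)))
      calc 2 * fluxConst α * (bigLam ε₀)⁻¹ * ‖W (k + 1) s‖ * physEnergy ε₀ W k s
          = κ₀ * ‖W (k + 1) s‖ * physEnergy ε₀ W k s := by rw [hκ₀]
        _ ≤ κ₀ * ‖W (k + 1) s‖ * A := this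
        _ = 2 * fluxConst α * (bigLam ε₀)⁻¹ * A * ‖W (k + 1) s‖ := by rw [hκ₀]; ring
    have hb2 : 2 * fluxConst α * (bigLam ε₀)⁻¹ * ‖W (k + 1 + 1) s‖ * physEnergy ε₀ W (k + 1) s
        ≤ κ₀ * S * ‖W (k + 1 + 1) s‖ := by
      have := mul_le_mul_of_nonneg_left (hS s) (mul_nonneg hκ₀nn (norm_nonneg (W (k + 1 + 1) s)))
      calc 2 * fluxConst α * (bigLam ε₀)⁻¹ * ‖W (k + 1 + 1) s‖ * physEnergy ε₀ W (k + 1) s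
          = κ₀ * ‖W (k + 1 + 1) s‖ * physEnergy ε₀ W (k + 1) s := by rw [hκ₀]
        _ ≤ κ₀ * ‖W (k + 1 + 1) s‖ * S := this
        _ = κ₀ * S * ‖W (k + 1 + 1) s‖ := by ring
    simp only [hD, hG]
    linarith
  -- integrate from `s₀` to `σ`
  have hstep : ∀ s₀ σ, s₀ ≤ σ →
      physEnergy ε₀ W (k + 1) σ ≤ physEnergy ε₀ W (k + 1) s₀ + κ₀ * M * (A + S) := by
    intro s₀ σ hle
    have hftc : ∫ s in s₀..σ, D s = physEnergy ε₀ W (k + 1) σ - physEnergy ε₀ W (k + 1) s₀ :=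
      intervalIntegral.integral_eq_sub_of_hasDerivAt (fun s _ => hderiv s) (hDcont.intervalIntegrable _ _)
    have hmono : ∫ s in s₀..σ, D s ≤ ∫ s in s₀..σ, G s :=
      intervalIntegral.integral_mono_on hle (hDcont.intervalIntegrable _ _) (hGcont.intervalIntegrable _ _)
        fun s _ => hDG s
    -- `∫_{s₀}^{σ} ‖W_j‖ ≤ M`
    have hpart : ∀ j : ℤ, ∫ s in s₀..σ, ‖W j s‖ ≤ M := by
      intro j
      rw [intervalIntegral.integral_of_le hle]
      exact (setIntegral_le_integral (hint j) (Eventually.of_forall fun s => norm_nonneg _)).trans (hM j)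
    have hGint : ∫ s in s₀..σ, G s
        = κ₀ * A * (∫ s in s₀..σ, ‖W (k + 1) s‖) + κ₀ * S * (∫ s in s₀..σ, ‖W (k + 1 + 1) s‖) := by
      simp only [hG]
      have c1 := (continuous_iff_continuousAt.2 fun σ' => (hW.law (k + 1) σ').continuousAt : Continuous (W (k + 1)))
      have c2 := (continuous_iff_continuousAt.2 fun σ' => (hW.law (k + 1 + 1) σ').continuousAt :
        Continuous (W (k + 1 + 1)))
      rw [intervalIntegral.integral_add ((c1.norm.intervalIntegrable _ _).const_mul _)
        ((c2.norm.intervalIntegrable _ _).const_mul _),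
        intervalIntegral.integral_const_mul, intervalIntegral.integral_const_mul]
    have hGle : ∫ s in s₀..σ, G s ≤ κ₀ * M * (A + S) := by
      rw [hGint]
      have h1 := mul_le_mul_of_nonneg_left (hpart (k + 1)) (mul_nonneg hκ₀nn hA0)
      have h2 := mul_le_mul_of_nonneg_left (hpart (k + 1 + 1)) (mul_nonneg hκ₀nn hS0)
      calc κ₀ * A * (∫ s in s₀..σ, ‖W (k + 1) s‖) + κ₀ * S * (∫ s in s₀..σ, ‖W (k + 1 + 1) s‖)
          ≤ κ₀ * A * M + κ₀ * S * M := add_le_add h1 h2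
        _ = κ₀ * M * (A + S) := by ring
    linarith
  -- let `s₀ → −∞`
  intro σ
  have hlim := tendsto_physEnergy_atBot hε hU (k + 1)
  refine le_of_forall_pos_lt_add fun δ hδ => ?_
  have hev : ∀ᶠ s in atBot, physEnergy ε₀ W (k + 1) s < δ := (tendsto_order.1 hlim).2 δ hδ
  obtain ⟨s₀, hs₀⟩ := (hev.and (eventually_le_atBot σ)).exists
  have := hstep s₀ σ hs₀.2
  rw [hκ₀] at this
  linarith [hs₀.1]

/-- **The lossy-conveyor bound.**  With `κ = 2C_AΛ⁻¹M < 1`: `E_k ≤ A` at all log-times implies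
`E_{k+1} ≤ (κ/(1−κ))·A` at all log-times (self-improvement of the conveyor inequality through the global
bound on `E_{k+1}`).
[cite: Tao2016AveragedNS, §4 Lemma 4.1 (4.8)–(4.10), §6.4; this file] -/
theorem physEnergy_succ_le_ratio (hε : 0 < ε₀) (hW : IsEternalVisc ε₀ νh α W) (hc : IsCancellingCoeff α)
    (hU : UniformBound W) {M : ℝ} (hint : ∀ n, Integrable (fun σ => ‖W n σ‖))
    (hM : ∀ n, ∫ σ, ‖W n σ‖ ≤ M) (hκ : 2 * fluxConst α * (bigLam ε₀)⁻¹ * M < 1) {k : ℤ} {A : ℝ}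
    (hA : ∀ σ, physEnergy ε₀ W k σ ≤ A) :
    ∀ σ, physEnergy ε₀ W (k + 1) σ
      ≤ 2 * fluxConst α * (bigLam ε₀)⁻¹ * M / (1 - 2 * fluxConst α * (bigLam ε₀)⁻¹ * M) * A := by
  set κ := 2 * fluxConst α * (bigLam ε₀)⁻¹ * M with hκdef
  -- the supremum of `E_{k+1}` over all log-times
  have hne : (Set.range (physEnergy ε₀ W (k + 1))).Nonempty := Set.range_nonempty _
  obtain ⟨S₀, hS₀⟩ := exists_physEnergy_le hε hW hU (k + 1)
  have hbdd : BddAbove (Set.range (physEnergy ε₀ W (k + 1))) := ⟨S₀, by rintro _ ⟨σ, rfl⟩; exact hS₀ σ⟩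
  set S := sSup (Set.range (physEnergy ε₀ W (k + 1))) with hSdef
  have hS : ∀ σ, physEnergy ε₀ W (k + 1) σ ≤ S := fun σ => le_csSup hbdd ⟨σ, rfl⟩
  have hstep := physEnergy_succ_le_action hε hW hc hU hint hM hA hS
  have hSle : S ≤ κ * (A + S) := csSup_le hne (by rintro _ ⟨σ, rfl⟩; exact hstep σ)
  have h1κ : 0 < 1 - κ := by linarith
  have hSle' : S ≤ κ / (1 - κ) * A := by
    rw [div_mul_eq_mul_div, le_div_iff₀ h1κ]
    linarith
  intro σ
  exact (hS σ).trans hSle'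

/-- **Geometric decay of the physical shell energies under small action**: with `κ = 2C_AΛ⁻¹M < 1` and `A₀`
a global bound of `E_0`, `E_n ≤ (κ/(1−κ))ⁿ A₀` at all log-times for every `n ∈ ℕ`.
[cite: Tao2016AveragedNS, §4 Lemma 4.1 (4.8)–(4.10), §6.4; this file] -/
theorem physEnergy_le_pow (hε : 0 < ε₀) (hW : IsEternalVisc ε₀ νh α W) (hc : IsCancellingCoeff α)
    (hU : UniformBound W) {M : ℝ} (hint : ∀ n, Integrable (fun σ => ‖W n σ‖))
    (hM : ∀ n, ∫ σ, ‖W n σ‖ ≤ M) (hκ : 2 * fluxConst α * (bigLam ε₀)⁻¹ * M < 1) {A₀ : ℝ}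
    (hA₀ : ∀ σ, physEnergy ε₀ W 0 σ ≤ A₀) :
    ∀ (n : ℕ) (σ : ℝ), physEnergy ε₀ W n σ
      ≤ (2 * fluxConst α * (bigLam ε₀)⁻¹ * M / (1 - 2 * fluxConst α * (bigLam ε₀)⁻¹ * M)) ^ n * A₀ := by
  intro n
  induction n with
  | zero => intro σ; simpa using hA₀ σ
  | succ n ih =>
    intro σ
    have h := physEnergy_succ_le_ratio hε hW hc hU hint hM hκ (k := (n : ℤ)) ih σ
    rw [show ((n + 1 : ℕ) : ℤ) = (n : ℤ) + 1 by push_cast; ring, pow_succ]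
    calc physEnergy ε₀ W ((n : ℤ) + 1) σ ≤ _ := h
      _ = _ := by ring

/-! ## No forward (S₁)-survival under small action -/

/-- **SMALL ACTION EXCLUDES FORWARD (S₁)-SURVIVAL.**  A uniformly bounded admissible eternal solution (any
covariant viscosity `ν̂ ≥ 0`) of a cancelling table at scale ratio `ε₀ > 0` whose per-shell actions obey
`∫‖W_n‖ ≤ M` with `(2+ε₀)·2C_AΛ⁻¹M < 1` is NOT forward (S₁)-surviving: the a=1-weighted energy
`(1+ε₀)ⁿE_n ≤ ((1+ε₀)κ/(1−κ))ⁿ A₀ → 0`.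
[cite: Tao2016AveragedNS, §4 Lemma 4.1 (4.8)–(4.10) with (4.3), the viscous equation before Thm. 4.2, §6.4; this file] -/
theorem not_survivingFwd_of_smallAction (hε : 0 < ε₀) (hW : IsEternalVisc ε₀ νh α W)
    (hc : IsCancellingCoeff α) (hU : UniformBound W) {M : ℝ} (hint : ∀ n, Integrable (fun σ => ‖W n σ‖))
    (hM : ∀ n, ∫ σ, ‖W n σ‖ ≤ M) (hsmall : (2 + ε₀) * (2 * fluxConst α * (bigLam ε₀)⁻¹ * M) < 1) :
    ¬ EternalSurvivingFwd 1 ε₀ W := by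
  set κ := 2 * fluxConst α * (bigLam ε₀)⁻¹ * M with hκdef
  have hκnn : 0 ≤ κ := by
    have h0 : 0 ≤ M := le_trans (integral_nonneg fun σ => norm_nonneg (W 0 σ)) (hM 0)
    have := fluxConst_nonneg α
    have := (bigLam_pos (by linarith : (-1 : ℝ) < ε₀)).le
    positivity
  have hκ1 : κ < 1 := by nlinarith
  have h1κ : 0 < 1 - κ := by linarith
  set r := κ / (1 - κ) with hrdef
  have hr0 : 0 ≤ r := div_nonneg hκnn h1κ.le
  -- the combined ratio `(1+ε₀) r < 1`
  have hq1 : (1 + ε₀) * r < 1 := by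
    rw [hrdef, mul_div_assoc', div_lt_one h1κ]; nlinarith
  have hq0 : 0 ≤ (1 + ε₀) * r := by positivity
  obtain ⟨A₀, hA₀⟩ := exists_physEnergy_le hε hW hU 0
  have hA₀nn : 0 ≤ A₀ := (physEnergy_nonneg ε₀ W 0 0).trans (hA₀ 0)
  have hpow := physEnergy_le_pow hε hW hc hU hint hM hκ1 hA₀
  rintro ⟨c, hc0, hcN⟩
  -- choose `N` with `((1+ε₀) r)^N A₀ < c`
  obtain ⟨N, hN⟩ : ∃ N : ℕ, ((1 + ε₀) * r) ^ N * A₀ < c := by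
    have ht : Tendsto (fun n : ℕ => ((1 + ε₀) * r) ^ n * A₀) atTop (𝓝 (0 * A₀)) :=
      (tendsto_pow_atTop_nhds_zero_of_lt_one hq0 hq1).mul_const A₀
    rw [zero_mul] at ht
    exact (ht.eventually (gt_mem_nhds hc0)).exists
  obtain ⟨n, hnN, σ, -, hcle⟩ := hcN N
  have hw : physWeight 1 ε₀ ^ n * (Real.exp (2 * σ) * ‖W n σ‖ ^ 2) = (1 + ε₀) ^ n * physEnergy ε₀ W n σ := by
    have := wtEnergy_eq hε W n σ; unfold wtEnergy at this; exact this
  rw [hw] at hcle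
  have hb : (1 + ε₀) ^ n * physEnergy ε₀ W n σ ≤ ((1 + ε₀) * r) ^ n * A₀ := by
    calc (1 + ε₀) ^ n * physEnergy ε₀ W n σ ≤ (1 + ε₀) ^ n * (r ^ n * A₀) :=
          mul_le_mul_of_nonneg_left (hpow n σ) (by positivity)
      _ = ((1 + ε₀) * r) ^ n * A₀ := by rw [mul_pow]; ring
  have hmono : ((1 + ε₀) * r) ^ n * A₀ ≤ ((1 + ε₀) * r) ^ N * A₀ :=
    mul_le_mul_of_nonneg_right (pow_le_pow_of_le_one hq0 hq1.le hnN) hA₀nn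
  linarith

/-! ## The small-action slice of K1ᵛ(1) is a theorem, and a case of the crux by name -/

/-- On a table of `InTableClass R` the flux constant is at most `64`. [cite: Tao2016AveragedNS, §4 (4.1), §6.1; cell dictionary `fluxConst_le_of_abs_le_one`] -/
theorem fluxConst_le_64 {R : ℝ} {α : Fin 4 → Fin 4 → Fin 4 → ℤ × ℤ × ℤ → ℝ} (hα : InTableClass R α) :
    fluxConst α ≤ 64 := by
  have h := fluxConst_le_of_abs_le_one α fun i₁ i₂ i₃ =>
    (hα.2.2 i₁ i₂ i₃ (0, 0, 1) (by simp [mem_shiftSet_iff])).1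
  norm_num at h
  exact h

/-- **THE SMALL-ACTION SLICE OF K1ᵛ(1).**  For every spread `R`, with threshold `εs = 1` and action budget
`1/400`: for all `ε₀ ∈ (0, 1]`, no table of `InTableClass R` carries a uniformly bounded admissible eternal
solution with covariant viscosity (any `ν̂ ≥ 0`) whose per-shell actions are all `≤ 1/400` and which is
forward (S₁)-surviving.  (The quantifier shape of `TaoCascade.NoSurvivingEternalViscBdd R 1` with one extra
hypothesis; `2C_AΛ⁻¹/400 ≤ 128/400` and `(2+ε₀)·0.32 < 1`.)
[cite: Tao2016AveragedNS, §4 Thm. 4.2 (statement shape), Lemma 4.1 (4.8)–(4.10), §6.4; this file] -/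
theorem noSurvivingEternalViscBdd_rung_smallAction (R : ℝ) :
    ∀ ε₀ : ℝ, 0 < ε₀ → ε₀ ≤ 1 →
      ∀ α : Fin 4 → Fin 4 → Fin 4 → ℤ × ℤ × ℤ → ℝ, InTableClass R α →
        ∀ (νh : ℝ) (W : ℤ → ℝ → Em 4), IsEternalVisc ε₀ νh α W → UniformBound W →
          (∀ n : ℤ, ∫ σ, ‖W n σ‖ ≤ 1 / 400) → ¬ EternalSurvivingFwd 1 ε₀ W := by
  intro ε₀ hε₀ hle α hα νh W hW hU hM
  obtain ⟨M', hM'⟩ := hW.action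
  have hint : ∀ n, Integrable (fun σ => ‖W n σ‖) := fun n => (hM' n).1
  refine not_survivingFwd_of_smallAction hε₀ hW hα.2.1 hU hint hM ?_
  have hC := fluxConst_le_64 hα
  have hC0 := fluxConst_nonneg α
  have hΛ1 : (bigLam ε₀)⁻¹ ≤ 1 := inv_le_one_of_one_le₀ (one_le_bigLam hε₀.le)
  have hΛ0 : 0 ≤ (bigLam ε₀)⁻¹ := inv_nonneg.2 (bigLam_pos (by linarith)).le
  have h1 : 2 * fluxConst α * (bigLam ε₀)⁻¹ * (1 / 400) ≤ 2 * 64 * 1 * (1 / 400) := by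
    have := mul_le_mul (mul_le_mul_of_nonneg_left hC (by norm_num : (0 : ℝ) ≤ 2)) hΛ1 hΛ0 (by positivity)
    nlinarith
  nlinarith

/-- The slice IS a case of the crux `NoSurvivingEternalViscBddOne` (with the crux's threshold, any budget).
[cite: Tao2016AveragedNS, §4 Thm. 4.2 (statement shape); cell vocabulary] -/
theorem smallAction_of_noSurvivingEternalViscBddOne (hK : NoSurvivingEternalViscBddOne) (R M₀ : ℝ)
    (hR : 1 ≤ R) :
    ∃ εs : ℝ, 0 < εs ∧ ∀ ε₀ : ℝ, 0 < ε₀ → ε₀ ≤ εs →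
      ∀ α : Fin 4 → Fin 4 → Fin 4 → ℤ × ℤ × ℤ → ℝ, InTableClass R α →
        ∀ (νh : ℝ) (W : ℤ → ℝ → Em 4), IsEternalVisc ε₀ νh α W → UniformBound W →
          (∀ n : ℤ, ∫ σ, ‖W n σ‖ ≤ M₀) → ¬ EternalSurvivingFwd 1 ε₀ W := by
  obtain ⟨εs, hεs, H⟩ := hK R hR
  exact ⟨εs, hεs, fun ε₀ hε₀ hle α hα νh W hW hU _ => H ε₀ hε₀ hle α hα νh W hW hU⟩

/-- Reading on the split: the small-action slice of the INVISCID child (ρ0) `stub_noSurvivingEternalBddOne`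
(`ν̂ = 0`, via `IsEternal.isEternalVisc`) holds with threshold `1` and budget `1/400`.
[cite: Tao2016AveragedNS, §4 Thm. 4.2 (statement shape); cell vocabulary] -/
theorem noSurvivingEternalBdd_rung_smallAction (R : ℝ) :
    ∀ ε₀ : ℝ, 0 < ε₀ → ε₀ ≤ 1 →
      ∀ α : Fin 4 → Fin 4 → Fin 4 → ℤ × ℤ × ℤ → ℝ, InTableClass R α →
        ∀ W : ℤ → ℝ → Em 4, IsEternal ε₀ α W → UniformBound W →
          (∀ n : ℤ, ∫ σ, ‖W n σ‖ ≤ 1 / 400) → ¬ EternalSurvivingFwd 1 ε₀ W :=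
  fun ε₀ hε₀ hle α hα W hW hU hM =>
    noSurvivingEternalViscBdd_rung_smallAction R ε₀ hε₀ hle α hα 0 W hW.isEternalVisc hU hM

/-- **Flux-degenerate tables (appended).**  If the outflow constants of the table vanish (`fluxConst α = 0`:
no `μ = (0,0,1)` coupling, energy cannot move between shells) then NO uniformly bounded admissible eternal
solution — any covariant viscosity `ν̂ ≥ 0`, ANY action, any `ε₀ > 0` — is forward (S₁)-surviving: the degenerate
corner of every class `InTableClass R` (which admits zero entries) is settled for K1ᵛ(1), (ρ0) and (ρ+) with no
threshold and no budget (`κ = 0` in `not_survivingFwd_of_smallAction`).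
[cite: Tao2016AveragedNS, §4 (4.1), Lemma 4.1 (4.8)–(4.10), §6.4; this file] -/
theorem not_survivingFwd_of_fluxConst_eq_zero (hε : 0 < ε₀) (hW : IsEternalVisc ε₀ νh α W)
    (hc : IsCancellingCoeff α) (hU : UniformBound W) (h0 : fluxConst α = 0) : ¬ EternalSurvivingFwd 1 ε₀ W := by
  obtain ⟨M, hM⟩ := hW.action
  exact not_survivingFwd_of_smallAction hε hW hc hU (fun n => (hM n).1) (fun n => (hM n).2)
    (by rw [h0]; norm_num)

/-- Hence `TaoCascade.NoSurvivingEternalViscBdd R 1`'s inner statement holds with threshold `1` on every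
flux-degenerate table of every class (inviscid child (ρ0) included via `IsEternal.isEternalVisc`).
[cite: Tao2016AveragedNS, §4 Thm. 4.2 (statement shape); this file] -/
theorem noSurvivingEternalViscBdd_rung_fluxDegenerate (R : ℝ) :
    ∀ ε₀ : ℝ, 0 < ε₀ → ε₀ ≤ 1 →
      ∀ α : Fin 4 → Fin 4 → Fin 4 → ℤ × ℤ × ℤ → ℝ, InTableClass R α → fluxConst α = 0 →
        ∀ (νh : ℝ) (W : ℤ → ℝ → Em 4), IsEternalVisc ε₀ νh α W → UniformBound W →
          ¬ EternalSurvivingFwd 1 ε₀ W :=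
  fun _ε₀ hε₀ _ _α hα h0 _νh _W hW hU => not_survivingFwd_of_fluxConst_eq_zero hε₀ hW hα.2.1 hU h0

end Summit.NavierStokesRegularity.NavierStokesRegularity.Theorems.NoSurvivingEternalViscBddOne.SmallAction

end
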